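import Summits.BirchSwinnertonDyer.BirchSwinnertonDyer.Theorems.PrintCf2RubinValueTwoKatzMeasureJZeroSeamPerUnitValues
import Summits.BirchSwinnertonDyer.BirchSwinnertonDyer.Theorems.PrintCf2RubinValueTwoEllipticUnitsGlobalUnits
import Literature.NumberTheory.EllipticCurves.DeShalitThetaTExpansionColemanBridgeFamily
import Literature.NumberTheory.EllipticCurves.DivisionPointsLaneCoherence
import Literature.NumberTheory.ComplexMultiplication.EllipticUnits.DeShalitDivisionPointsLattice
import HarnessLib

/-!
# The bridge identities (hβ_i) `g_{β_i} = (Q_{R,i}^ψ ∘ [1]_{P′,f}) ∘ [a]_f` for a FAMILY of units reading theta values, with ONE Tate unit `a`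
# (de Shalit II §4.9 (ii) / II §4.14 (38), assembled from the division points; family form of `PerUnitBridge`; proofs only)

Cell `bsd-print-cf2`, width seat `bsd-line-cf2c-w4` g15, brick B10f-d.  Same assembly as `PerUnitBridge`
(`exists_unit_relColemanSeries_eq_subst_subst_of_thetaReadings`), but instantiating cf2-p1-w2's FAMILY bridge
`DeShalitThetaTExpansionColemanBridgeFamily.exists_unit_forall_relColemanSeries_eq_subst_subst_of_divisionPoints`: the division points
`U_m = ι_v ξ(u_{m+1})`, their order (N2), coherence (N3) and chart identity (he′) are SHARED by all units, so ONE `a ∈ 𝒪_Fˣ` serves every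
`β_i` (`i ∈ J`: e.g. the two label families `𝔞`, `𝔟` of the seam); per unit: the ideal `𝔞_i`, the lattice `L′_i = 𝔞_i⁻¹L` with representatives
`S_i`, the theta datum `(K_i, x_{i,c})`, the permutation `e_i`, and elements `x_{i,m} ∈ K(𝔪v^{m+1})` under the theta values read by `(β_i)_m`.

★★★ `exists_unit_forall_relColemanSeries_eq_subst_subst_of_thetaReadings`: **`∃ a ∈ 𝒪_Fˣ, ∀ i, g_{β_i} = (Q_{R,i}^ψ ∘ [1]_{P′,f}) ∘ [a]_f`** —
the hypotheses (hβ_i) of `KatzMeasureJZeroSeam.exists_unit_forall_map_relCoatesWiles_eq_of_divisionPoints` / `map_relCoatesWiles_eq_of_bridge`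
with a common `a`.  Remaining hypotheses as in `PerUnitBridge` ((N1) `hU`, readings, theta data over `R`, CM datum, `ℤ₂`-datum).
No summit statement is proved; BSD is not proved by any of this.

## References
* [deShalit1987] E. de Shalit, *Iwasawa theory of elliptic curves with complex multiplication* (1987), I §2.2 Theorem, II §4.4 (iv), (12),
  II §4.9 (23)–(24) and Proposition (ii) (p. 62–63), II §4.14 (38).
* [SilvermanAEC2009] J. H. Silverman, *The Arithmetic of Elliptic Curves*, 2nd ed. (2009), III.2.3, VI.3.6 (b), VII.2.2.
-/

-- the summit namespace `Summit.BirchSwinnertonDyer.BirchSwinnertonDyer` repeats the problem name by design (D-0017)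
set_option linter.dupNamespace false
set_option autoImplicit false

noncomputable section

open scoped Classical
open scoped NumberField
open PeriodPair Literature.NumberTheory.EllipticCurves
open Literature.NumberTheory.ComplexMultiplication.EllipticUnits
open Summit.BirchSwinnertonDyer.BirchSwinnertonDyer.Theorems.PrintCf2.EllipticUnitsLocal
open Summit.BirchSwinnertonDyer.BirchSwinnertonDyer.Theorems.PrintCf2.EllipticUnitsGlobal
open NumberField Field IsDedekindDomain IsDedekindDomain.HeightOneSpectrum ValuativeRel PowerSeries
open Literature.NumberTheory.NumberFields
open Literature.NumberTheory.GaloisRepresentations Literature.NumberTheory.GaloisRepresentations.IsNonarchimedeanLocalField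
  Literature.NumberTheory.GaloisRepresentations.LubinTate Literature.NumberTheory.EllipticCurves.FormalGroupChart _root_.WeierstrassCurve

namespace Summit.BirchSwinnertonDyer.BirchSwinnertonDyer.Theorems.PrintCf2.KatzMeasureJZeroSeam

attribute [local instance] ltNormUniformSpace ltNormIsUniformAddGroup rk1 nF nE fintypeResidueField

variable {K : Type} [Field K] [NumberField K] {𝔪 : Ideal (𝓞 K)} {v : HeightOneSpectrum (𝓞 K)}

/-- ★★★ **(hβ_i) from theta readings, ONE Tate unit for a family**: `∃ a ∈ 𝒪_Fˣ, ∀ i, g_{β_i} = (Q_{R,i}^ψ ∘ [1]_{P′,f}) ∘ [a]_f` for units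
`β_i ∈ 𝒰_E` whose components read the theta values `Θ(1; 𝔪v^{m+1}, 𝔞_i)` (de Shalit II §4.9 (ii), II §4.14 (38)), from cf2-p1-w2's family
bridge with (N2), (N3), (he′), (hval_i) discharged from readings — see the module docstring.
[cite: deShalit1987, I §2.2 Theorem, II §4.4 (iv), II §4.9 (23)–(24), Proposition (ii)] [cite: SilvermanAEC2009, III.2.3, VI.3.6 (b), VII.2.2] -/
theorem exists_unit_forall_relColemanSeries_eq_subst_subst_of_thetaReadings
    -- the lane: a local field `F` with `e : 𝒪_F ≃ ℤ₂`, a uniformizer `π` with `e π = π_ℤ`, the ordinary `ℤ₂`-datum of the integer model `W`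
    {F : Type} [Field F] [ValuativeRel F] [TopologicalSpace F] [IsNonarchimedeanLocalField F]
    (e : 𝒪[F] ≃+* ℤ_[2]) (hq : residueFieldCard F = 2)
    {π : 𝒪[F]} (hπ : (valuation F).IsUniformizer (π : F))
    {πZ : ℤ_[2]} (heπ : e π = πZ) (hA : IsLTRing πZ 2) {P : PowerSeries ℤ_[2]} (hP : IsLTSeries πZ 2 P) (W : WeierstrassCurve ℤ)
    (hV : (W.map (Int.castRingHom ℤ_[2])).formalGroupLaw = ltF hA hP) {ϖ : ℤ_[2]} (hp : ((2 : ℕ) : ℤ_[2]) = ϖ * πZ) (hϖ : IsUnit ϖ)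
    (E : IntermediateField F (AlgebraicClosure F))
    [FiniteDimensional F E] [Normal F E] [IsGalois F E]
    (hE : E ≤ maxUnramified F) {σ₀ : absoluteGaloisGroup F} (hσ₀ : IsAbsArithFrob σ₀)
    [hEll : ∀ m : ℕ, (curveOver (E ⊔ ltField π m : IntermediateField F (AlgebraicClosure F))
      ((W.map (Int.castRingHom ℤ_[2])).map ((LTCoeff.of F).toRingHom.comp e.symm.toRingHom))).IsElliptic]
    -- the units `β_i ∈ 𝒰_E` whose components READ the theta values `Θ(1; 𝔪v^{m+1}, 𝔞_i)` (`β_i = ofGlobalUnits (ellipticUnitsGlobal …)`)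
    (ι : K →+* ℂ) (ιv : AlgebraicClosure K →+* AlgebraicClosure F) (h𝔪1 : 𝔪 ≠ ⊤)
    {J : Type*} (β : J → RelNormCoherentUnits hπ E) (𝔞 : J → Ideal (𝓞 K)) (xf : J → ∀ m : ℕ, rayClassField K (𝔪 * v.asIdeal ^ (m + 1)))
    (hxf : ∀ i m, IsThetaValueOne ι (𝔪 * v.asIdeal ^ (m + 1)) (𝔞 i)
      (algClosureEmb ι ((xf i m : rayClassField K (𝔪 * v.asIdeal ^ (m + 1))) : AlgebraicClosure K)))
    (hβv : ∀ (i : J) (m : ℕ), (((((β i).val m : unitBall (E ⊔ ltField π m : IntermediateField F (AlgebraicClosure F))) :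
        (E ⊔ ltField π m : IntermediateField F (AlgebraicClosure F))) : AlgebraicClosure F)) =
      ιv ((xf i m : rayClassField K (𝔪 * v.asIdeal ^ (m + 1))) : AlgebraicClosure K))
    -- the split prime: `v = (π₀)`, `2 = π₀π₁`, `π₀` prime, `π₀ ∤ π₁`, `π₀ᵏ ∉ 𝔪`; `β_K π₀ ≡ 1 (mod 𝔪)`
    {π₀ π₁ βK : 𝓞 K} (hv0 : v.asIdeal = Ideal.span {π₀}) (h2K : (2 : 𝓞 K) = π₀ * π₁) (hprime : Prime π₀) (hπ₁ : ¬ π₀ ∣ π₁)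
    (hπ₀𝔪 : ∀ k : ℕ, (π₀ ^ k : 𝓞 K) ∉ 𝔪) (hβK : βK * π₀ - 1 ∈ 𝔪)
    -- the model lattice `L = Ω·ι(𝔪)` of `W ⊗ ℂ`; per unit `L′_i = 𝔞_i⁻¹L` with representatives `S_i`
    (L : PeriodPair) (La : J → PeriodPair) (S : J → Finset ℂ) {Ω : ℂ} (hS : ∀ i, L.IsLatticeReps (La i) (S i))
    (hLa : ∀ i, (La i).lattice = idealInvLattice ι (𝔞 i) L.lattice)
    (hL : ∀ z : ℂ, z ∈ L.lattice ↔ ∃ a ∈ 𝔪, z = Ω * ι (a : K)) (hΩ : Ω ≠ 0)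
    (h₂ : L.g₂ = (W.baseChange ℂ).c₄ / 12) (h₃ : L.g₃ = (W.baseChange ℂ).c₆ / 216)
    -- the theta datum over `R`, read `𝔓`-adically by `ψ` and algebraically by `j`
    {R : Type*} [CommRing R] (ψ : R →+* unitBall E) (j : R →+* AlgebraicClosure K)
    (hψj : ∀ r : R, ((((ψ r : unitBall E) : E) : AlgebraicClosure F)) =
      ιv (j r))
    (x₀ y₀ x₁ y₁ αR : R) (Kc : J → R) (x : J → ℂ → R) (uc : J → ℂ → Rˣ) (hu : ∀ i, ∀ c ∈ (S i).erase 0, (uc i c : R) = x₀ - x i c)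
    (hKj : ∀ i, algClosureEmb ι (j (Kc i)) = L.deltaRatio (La i) * (L.g₂ ^ 3 - 27 * L.g₃ ^ 2) ^ ((S i).card - 1))
    (hxj : ∀ i, ∀ c ∈ (S i).erase 0, algClosureEmb ι (j (x i c)) = ℘[L] c - (W.baseChange ℂ).b₂ / 12)
    (hx₀ : algClosureEmb ι (j x₀) = ℘[L] Ω - (W.baseChange ℂ).b₂ / 12)
    (hy₀ : algClosureEmb ι (j y₀) = (℘'[L] Ω - (W.baseChange ℂ).a₁ * (℘[L] Ω - (W.baseChange ℂ).b₂ / 12) - (W.baseChange ℂ).a₃) / 2)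
    (hx₁ : algClosureEmb ι (j x₁) = ℘[L] (ι (π₀ : K) * Ω) - (W.baseChange ℂ).b₂ / 12)
    (hy₁ : algClosureEmb ι (j y₁) = (℘'[L] (ι (π₀ : K) * Ω) - (W.baseChange ℂ).a₁ * (℘[L] (ι (π₀ : K) * Ω) - (W.baseChange ℂ).b₂ / 12) -
      (W.baseChange ℂ).a₃) / 2)
    (hαj : algClosureEmb ι (j αR) = ι (π₀ : K))
    (τ : R →+* R) (hτ : ((frobUnitBall E σ₀).symm : unitBall E →+* unitBall E).comp ψ = ψ.comp τ) (hKτ : ∀ i, τ (Kc i) = Kc i)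
    (eι : J → ℂ → ℂ) (heT : ∀ i, ∀ c ∈ (S i).erase 0, eι i c ∈ (S i).erase 0) (hinj : ∀ i, Set.InjOn (eι i) ((S i).erase 0 : Finset ℂ))
    (hsurj : ∀ i, Set.SurjOn (eι i) ((S i).erase 0 : Finset ℂ) ((S i).erase 0 : Finset ℂ))
    (hxτ : ∀ i, ∀ c ∈ (S i).erase 0, τ (x i c) = x i (eι i c))
    (hτx₀ : ∀ m : ℕ, algClosureEmb ι (j (τ^[m + 1] x₀)) = ℘[L] (ι ((βK ^ (m + 1) : 𝓞 K) : K) * Ω) - (W.baseChange ℂ).b₂ / 12)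
    (hτy₀ : ∀ m : ℕ, algClosureEmb ι (j (τ^[m + 1] y₀)) = (℘'[L] (ι ((βK ^ (m + 1) : 𝓞 K) : K) * Ω) -
      (W.baseChange ℂ).a₁ * (℘[L] (ι ((βK ^ (m + 1) : 𝓞 K) : K) * Ω) - (W.baseChange ℂ).b₂ / 12) - (W.baseChange ℂ).a₃) / 2)
    -- the formal CM action over `R`, the transformation pair and its re-centred `R`-lifts, the series identities over `R`
    {T : PowerSeries R} (hT0 : PowerSeries.constantCoeff T = 0)
    (hTP : T.map ψ = (P.map ((LTCoeff.of F).toRingHom.comp e.symm.toRingHom)).map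
      (algebraMap (LTCoeff F) (unitBall E)))
    {PC QC : Polynomial ℂ}
    (hT : ∀ z : ℂ, z ∉ L.lattice → ι (π₀ : K) * z ∉ L.lattice → PC.eval (℘[L] z) = ℘[L] (ι (π₀ : K) * z) * QC.eval (℘[L] z))
    (hQC : ∀ z : ℂ, z ∉ L.lattice → ι (π₀ : K) * z ∉ L.lattice → QC.eval (℘[L] z) ≠ 0)
    {Pr Qr : Polynomial R} {s : ℂ} (hs : s ≠ 0)
    (hQr : Qr.map ((algClosureEmb ι).comp j) = Polynomial.C s * QC.comp (Polynomial.X + Polynomial.C ((W.baseChange ℂ).b₂ / 12)))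
    (hPr : Pr.map ((algClosureEmb ι).comp j) = Polynomial.C s * (PC.comp (Polynomial.X + Polynomial.C ((W.baseChange ℂ).b₂ / 12)) -
      Polynomial.C ((W.baseChange ℂ).b₂ / 12) * QC.comp (Polynomial.X + Polynomial.C ((W.baseChange ℂ).b₂ / 12))))
    (hidX : (((W.map (Int.castRingHom R)).translateX x₁ y₁).subst T + C (0 : R)) *
        Polynomial.aeval ((W.map (Int.castRingHom R)).translateX x₀ y₀ + C (0 : R)) Qr =
      Polynomial.aeval ((W.map (Int.castRingHom R)).translateX x₀ y₀ + C (0 : R)) Pr)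
    (hidY : C αR * (2 * PowerSeries.subst T ((W.map (Int.castRingHom R)).translateY x₁ y₁) +
            C (W.map (Int.castRingHom R)).a₁ * PowerSeries.subst T ((W.map (Int.castRingHom R)).translateX x₁ y₁) +
            C (W.map (Int.castRingHom R)).a₃) *
          Polynomial.aeval ((W.map (Int.castRingHom R)).translateX x₀ y₀ + C (0 : R)) Qr +
        (PowerSeries.subst T ((W.map (Int.castRingHom R)).translateX x₁ y₁) + C (0 : R)) *
          Polynomial.aeval ((W.map (Int.castRingHom R)).translateX x₀ y₀ + C (0 : R)) (Polynomial.derivative Qr) *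
          (2 * (W.map (Int.castRingHom R)).translateY x₀ y₀ +
            C (W.map (Int.castRingHom R)).a₁ * (W.map (Int.castRingHom R)).translateX x₀ y₀ + C (W.map (Int.castRingHom R)).a₃) =
      Polynomial.aeval ((W.map (Int.castRingHom R)).translateX x₀ y₀ + C (0 : R)) (Polynomial.derivative Pr) *
        (2 * (W.map (Int.castRingHom R)).translateY x₀ y₀ +
          C (W.map (Int.castRingHom R)).a₁ * (W.map (Int.castRingHom R)).translateX x₀ y₀ + C (W.map (Int.castRingHom R)).a₃))
    -- LEVELWISE readings of `ξ(u_{m+1})`, `ξ(Ω/π₀^{m+1})` in `M_m`, of `ξ(Ω + u_{m+2})`, `ξ(π₀(Ω + u_{m+2}))` in `M_{m+1}`, through `K̄`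
    (xu yu xq yq xw yw xz yz : ℕ → AlgebraicClosure K)
    (hxu : ∀ m : ℕ, algClosureEmb ι (xu m) =
      ℘[L] (ι ((βK ^ (m + 1) : 𝓞 K) : K) * Ω - Ω / ι ((π₀ ^ (m + 1) : 𝓞 K) : K)) - (W.baseChange ℂ).b₂ / 12)
    (hyu : ∀ m : ℕ, algClosureEmb ι (yu m) = (℘'[L] (ι ((βK ^ (m + 1) : 𝓞 K) : K) * Ω - Ω / ι ((π₀ ^ (m + 1) : 𝓞 K) : K)) -
      (W.baseChange ℂ).a₁ * (℘[L] (ι ((βK ^ (m + 1) : 𝓞 K) : K) * Ω - Ω / ι ((π₀ ^ (m + 1) : 𝓞 K) : K)) - (W.baseChange ℂ).b₂ / 12) -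
      (W.baseChange ℂ).a₃) / 2)
    (hxq : ∀ m : ℕ, algClosureEmb ι (xq m) = ℘[L] (Ω / ι ((π₀ ^ (m + 1) : 𝓞 K) : K)) - (W.baseChange ℂ).b₂ / 12)
    (hyq : ∀ m : ℕ, algClosureEmb ι (yq m) = (℘'[L] (Ω / ι ((π₀ ^ (m + 1) : 𝓞 K) : K)) -
      (W.baseChange ℂ).a₁ * (℘[L] (Ω / ι ((π₀ ^ (m + 1) : 𝓞 K) : K)) - (W.baseChange ℂ).b₂ / 12) - (W.baseChange ℂ).a₃) / 2)
    (hxw : ∀ m : ℕ, algClosureEmb ι (xw m) =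
      ℘[L] (Ω + (ι ((βK ^ (m + 2) : 𝓞 K) : K) * Ω - Ω / ι ((π₀ ^ (m + 2) : 𝓞 K) : K))) - (W.baseChange ℂ).b₂ / 12)
    (hyw : ∀ m : ℕ, algClosureEmb ι (yw m) = (℘'[L] (Ω + (ι ((βK ^ (m + 2) : 𝓞 K) : K) * Ω - Ω / ι ((π₀ ^ (m + 2) : 𝓞 K) : K))) -
      (W.baseChange ℂ).a₁ * (℘[L] (Ω + (ι ((βK ^ (m + 2) : 𝓞 K) : K) * Ω - Ω / ι ((π₀ ^ (m + 2) : 𝓞 K) : K))) -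
        (W.baseChange ℂ).b₂ / 12) - (W.baseChange ℂ).a₃) / 2)
    (hxz : ∀ m : ℕ, algClosureEmb ι (xz m) =
      ℘[L] (ι (π₀ : K) * (Ω + (ι ((βK ^ (m + 2) : 𝓞 K) : K) * Ω - Ω / ι ((π₀ ^ (m + 2) : 𝓞 K) : K)))) - (W.baseChange ℂ).b₂ / 12)
    (hyz : ∀ m : ℕ, algClosureEmb ι (yz m) =
      (℘'[L] (ι (π₀ : K) * (Ω + (ι ((βK ^ (m + 2) : 𝓞 K) : K) * Ω - Ω / ι ((π₀ ^ (m + 2) : 𝓞 K) : K)))) -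
        (W.baseChange ℂ).a₁ * (℘[L] (ι (π₀ : K) * (Ω + (ι ((βK ^ (m + 2) : 𝓞 K) : K) * Ω - Ω / ι ((π₀ ^ (m + 2) : 𝓞 K) : K)))) -
          (W.baseChange ℂ).b₂ / 12) - (W.baseChange ℂ).a₃) / 2)
    (XU YU XQ YQ : ∀ m : ℕ, ↥(E ⊔ ltField π m : IntermediateField F (AlgebraicClosure F)))
    (XW YW XZ YZ : ∀ m : ℕ, ↥(E ⊔ ltField π (m + 1) : IntermediateField F (AlgebraicClosure F)))
    (hXU : ∀ m, ((XU m : ↥(E ⊔ ltField π m : IntermediateField F (AlgebraicClosure F))) : AlgebraicClosure F) =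
      ιv (xu m))
    (hYU : ∀ m, ((YU m : ↥(E ⊔ ltField π m : IntermediateField F (AlgebraicClosure F))) : AlgebraicClosure F) =
      ιv (yu m))
    (hXQ : ∀ m, ((XQ m : ↥(E ⊔ ltField π m : IntermediateField F (AlgebraicClosure F))) : AlgebraicClosure F) =
      ιv (xq m))
    (hYQ : ∀ m, ((YQ m : ↥(E ⊔ ltField π m : IntermediateField F (AlgebraicClosure F))) : AlgebraicClosure F) =
      ιv (yq m))
    (hXW : ∀ m, ((XW m : ↥(E ⊔ ltField π (m + 1) : IntermediateField F (AlgebraicClosure F))) : AlgebraicClosure F) =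
      ιv (xw m))
    (hYW : ∀ m, ((YW m : ↥(E ⊔ ltField π (m + 1) : IntermediateField F (AlgebraicClosure F))) : AlgebraicClosure F) =
      ιv (yw m))
    (hXZ : ∀ m, ((XZ m : ↥(E ⊔ ltField π (m + 1) : IntermediateField F (AlgebraicClosure F))) : AlgebraicClosure F) =
      ιv (xz m))
    (hYZ : ∀ m, ((YZ m : ↥(E ⊔ ltField π (m + 1) : IntermediateField F (AlgebraicClosure F))) : AlgebraicClosure F) =
      ιv (yz m))
    -- (N1): de Shalit's division points lie in the kernel of reduction
    (hU : ∀ (m : ℕ) (h : (curveOver (E ⊔ ltField π m : IntermediateField F (AlgebraicClosure F))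
        ((W.map (Int.castRingHom ℤ_[2])).map ((LTCoeff.of F).toRingHom.comp e.symm.toRingHom))).toAffine.Nonsingular
        (XU m) (YU m)),
      (.some (XU m) (YU m) h : (curveOver (E ⊔ ltField π m : IntermediateField F (AlgebraicClosure F))
        ((W.map (Int.castRingHom ℤ_[2])).map ((LTCoeff.of F).toRingHom.comp e.symm.toRingHom))).toAffine.Point) ∈
      kernel (NormedField.valuation (K := ↥(E ⊔ ltField π m : IntermediateField F (AlgebraicClosure F))))
        (curveOver (E ⊔ ltField π m : IntermediateField F (AlgebraicClosure F))
          ((W.map (Int.castRingHom ℤ_[2])).map ((LTCoeff.of F).toRingHom.comp e.symm.toRingHom)))) :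
    ∃ a : 𝒪[F]ˣ, ∀ i : J,
      relColemanSeries hπ E hq hE hσ₀ (β i) =
        PowerSeries.subst ((hom (isLTRing_LTCoeff hπ) (isLTSeries_LTCoeff _) (isLTSeries_LTCoeff _)
            (LTCoeff.of F (a : 𝒪[F]))).map
            (algebraMap (LTCoeff F) (unitBall E)))
          (PowerSeries.subst ((hom (isLTRing_LTCoeff hπ) (isLTSeries_map_LTCoeff_of_degree_one e hq heπ hP) (isLTSeries_LTCoeff _) 1).map
            (algebraMap (LTCoeff F) (unitBall E)))
            (PowerSeries.map ψ (C (Kc i) * ∏ c ∈ (S i).erase 0,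
              PowerSeries.invOfUnit (((W.map (Int.castRingHom R)).translateX x₀ y₀).subst (W.map (Int.castRingHom R)).formalNeg - C (x i c))
                (uc i c) ^ 6))) := by
  -- abbreviations: the readings `ι_ℂ = ι̂`, `ι_v`
  have hπ₀0 : π₀ ≠ 0 := hprime.ne_zero
  have hια : ∀ n : ℕ, ι ((π₀ ^ n : 𝓞 K) : K) ≠ 0 := fun n => (map_ne_zero ι).mpr (by exact_mod_cast pow_ne_zero n hπ₀0)
  -- (0) lattice bookkeeping: non-membership of the arguments
  have hΩL : Ω ∉ L.lattice := notMem_lattice_of_model ι hL hΩ h𝔪1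
  have hπΩ : ι (π₀ : K) * Ω ∉ L.lattice := mul_gen_notMem ι hL hΩ (by simpa using hπ₀𝔪 1)
  have huL : ∀ n : ℕ, ι ((βK ^ (n + 1) : 𝓞 K) : K) * Ω - Ω / ι ((π₀ ^ (n + 1) : 𝓞 K) : K) ∉ L.lattice := fun n =>
    divisionPt_succ_notMem ι hL hΩ h2K hprime hπ₁ n
  have hwL : ∀ n : ℕ, ι ((βK ^ n : 𝓞 K) : K) * Ω ∉ L.lattice := fun n => mul_pow_notMem_lattice_of_model ι hL hΩ h𝔪1 hβK n
  have hqL : ∀ n : ℕ, Ω / ι ((π₀ ^ (n + 1) : 𝓞 K) : K) ∉ L.lattice := fun n h => hΩL (by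
    have h1 := isCMLattice_of_model ι hL (π₀ ^ (n + 1)) _ h
    have e1 : ι ((π₀ ^ (n + 1) : 𝓞 K) : K) * (Ω / ι ((π₀ ^ (n + 1) : 𝓞 K) : K)) = Ω := by
      have h0 := hια (n + 1)
      field_simp
    rwa [e1] at h1)
  have hΩu : ∀ n : ℕ, Ω + (ι ((βK ^ (n + 2) : 𝓞 K) : K) * Ω - Ω / ι ((π₀ ^ (n + 2) : 𝓞 K) : K)) ∉ L.lattice := fun n =>
    add_divisionPt_notMem ι hL hΩ hβK hπ₀0 (hπ₀𝔪 (n + 2))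
  have hπΩu : ∀ n : ℕ, ι (π₀ : K) * (Ω + (ι ((βK ^ (n + 2) : 𝓞 K) : K) * Ω - Ω / ι ((π₀ ^ (n + 2) : 𝓞 K) : K))) ∉ L.lattice :=
    fun n => mul_add_divisionPt_succ_notMem ι hL hΩ hβK hπ₀0 (n := n + 1) (hπ₀𝔪 (n + 2))
  have hαu : ∀ m : ℕ, algClosureEmb ι (j αR) * (ι ((βK ^ (m + 2) : 𝓞 K) : K) * Ω - Ω / ι ((π₀ ^ (m + 2) : 𝓞 K) : K)) -
      (ι ((βK ^ (m + 1) : 𝓞 K) : K) * Ω - Ω / ι ((π₀ ^ (m + 1) : 𝓞 K) : K)) ∈ L.lattice := fun m => by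
    rw [hαj]; exact mul_divisionPt_succ_sub_mem ι hL hβK hπ₀0 (m + 1)
  -- the CM datum phrased with `α = ι̂ (j α_R)`
  have hT' : ∀ z : ℂ, z ∉ L.lattice → algClosureEmb ι (j αR) * z ∉ L.lattice →
      PC.eval (℘[L] z) = ℘[L] (algClosureEmb ι (j αR) * z) * QC.eval (℘[L] z) := by rw [hαj]; exact hT
  have hπΩ' : algClosureEmb ι (j αR) * Ω ∉ L.lattice := by rw [hαj]; exact hπΩ
  have hπΩu' : ∀ n : ℕ, algClosureEmb ι (j αR) * (Ω + (ι ((βK ^ (n + 2) : 𝓞 K) : K) * Ω - Ω / ι ((π₀ ^ (n + 2) : 𝓞 K) : K))) ∉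
      L.lattice := by rw [hαj]; exact hπΩu
  have hx₁' : algClosureEmb ι (j x₁) = ℘[L] (algClosureEmb ι (j αR) * Ω) - (W.baseChange ℂ).b₂ / 12 := by rw [hαj]; exact hx₁
  have hy₁' : algClosureEmb ι (j y₁) = (℘'[L] (algClosureEmb ι (j αR) * Ω) - (W.baseChange ℂ).a₁ * (℘[L] (algClosureEmb ι (j αR) * Ω) -
      (W.baseChange ℂ).b₂ / 12) - (W.baseChange ℂ).a₃) / 2 := by rw [hαj]; exact hy₁
  have hxz' : ∀ m : ℕ, algClosureEmb ι (xz m) = ℘[L] (algClosureEmb ι (j αR) * (Ω + (ι ((βK ^ (m + 2) : 𝓞 K) : K) * Ω -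
      Ω / ι ((π₀ ^ (m + 2) : 𝓞 K) : K)))) - (W.baseChange ℂ).b₂ / 12 := by rw [hαj]; exact hxz
  have hyz' : ∀ m : ℕ, algClosureEmb ι (yz m) = (℘'[L] (algClosureEmb ι (j αR) * (Ω + (ι ((βK ^ (m + 2) : 𝓞 K) : K) * Ω -
      Ω / ι ((π₀ ^ (m + 2) : 𝓞 K) : K)))) - (W.baseChange ℂ).a₁ * (℘[L] (algClosureEmb ι (j αR) * (Ω + (ι ((βK ^ (m + 2) : 𝓞 K) : K) * Ω -
      Ω / ι ((π₀ ^ (m + 2) : 𝓞 K) : K)))) - (W.baseChange ℂ).b₂ / 12) - (W.baseChange ℂ).a₃) / 2 := by rw [hαj]; exact hyz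
  have hQ : ∀ m : ℕ, QC.eval (℘[L] (Ω + (ι ((βK ^ (m + 2) : 𝓞 K) : K) * Ω - Ω / ι ((π₀ ^ (m + 2) : 𝓞 K) : K)))) ≠ 0 := fun m =>
    hQC _ (hΩu m) (hπΩu m)
  -- the two presentations share one integral model
  have hWR : (W.map (Int.castRingHom R)).map ψ =
      ((W.map (Int.castRingHom ℤ_[2])).map ((LTCoeff.of F).toRingHom.comp e.symm.toRingHom)).map
        (algebraMap (LTCoeff F) (unitBall E)) := by
    rw [WeierstrassCurve.map_map (W.map (Int.castRingHom ℤ_[2]))]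
    exact WeierstrassCurve.map_intCast_eq_map_intCast W _ _
  -- readings of `R`-points one level up
  have hread : ∀ (m : ℕ) (r : R), ((((inclUnitBall (F := F) (le_sup_left : E ≤ E ⊔ ltField π m) (ψ r) :
      unitBall (E ⊔ ltField π m : IntermediateField F (AlgebraicClosure F))) :
      (E ⊔ ltField π m : IntermediateField F (AlgebraicClosure F))) : AlgebraicClosure F)) =
      ιv (j r) := fun m r => by
    rw [coe_inclUnitBall, IntermediateField.coe_inclusion]; exact hψj r
  -- nonsingularity of the levelwise points
  have hnU : ∀ m : ℕ, (curveOver (E ⊔ ltField π m : IntermediateField F (AlgebraicClosure F))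
      ((W.map (Int.castRingHom ℤ_[2])).map ((LTCoeff.of F).toRingHom.comp e.symm.toRingHom))).toAffine.Nonsingular
      (XU m) (YU m) := fun m =>
    nonsingular_curveOver_of_readings e _ W (algClosureEmb ι) ιv L h₂ h₃ (huL m)
      (hxu m) (hyu m) (hXU m) (hYU m)
  have hnQ : ∀ m : ℕ, (curveOver (E ⊔ ltField π m : IntermediateField F (AlgebraicClosure F))
      ((W.map (Int.castRingHom ℤ_[2])).map ((LTCoeff.of F).toRingHom.comp e.symm.toRingHom))).toAffine.Nonsingular
      (XQ m) (YQ m) := fun m =>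
    nonsingular_curveOver_of_readings e _ W (algClosureEmb ι) ιv L h₂ h₃ (hqL m)
      (hxq m) (hyq m) (hXQ m) (hYQ m)
  have h0 : ∀ m : ℕ, (curveOver (E ⊔ ltField π m : IntermediateField F (AlgebraicClosure F))
      ((W.map (Int.castRingHom ℤ_[2])).map ((LTCoeff.of F).toRingHom.comp e.symm.toRingHom))).toAffine.Nonsingular
      (((inclUnitBall (F := F) (le_sup_left : E ≤ E ⊔ ltField π m) (ψ (τ^[m + 1] x₀)) :
        unitBall (E ⊔ ltField π m : IntermediateField F (AlgebraicClosure F))) :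
        (E ⊔ ltField π m : IntermediateField F (AlgebraicClosure F))))
      (((inclUnitBall (F := F) (le_sup_left : E ≤ E ⊔ ltField π m) (ψ (τ^[m + 1] y₀)) :
        unitBall (E ⊔ ltField π m : IntermediateField F (AlgebraicClosure F))) :
        (E ⊔ ltField π m : IntermediateField F (AlgebraicClosure F)))) := fun m =>
    nonsingular_curveOver_of_readings e _ W (algClosureEmb ι) ιv L h₂ h₃ (hwL (m + 1))
      (hτx₀ m) (hτy₀ m) (hread m _) (hread m _)
  -- the value identity «which is precisely `e_m(𝔞)`»
  have hc𝔣 : ∀ m : ℕ, Ideal.span {π₀ ^ (m + 1)} * 𝔪 ≠ ⊤ := fun m h => h𝔪1 (eq_top_iff.mpr (h ▸ Ideal.mul_le_left))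
  have hideal : ∀ m : ℕ, 𝔪 * v.asIdeal ^ (m + 1) = Ideal.span {π₀ ^ (m + 1)} * 𝔪 := fun m => by
    rw [hv0, Ideal.span_singleton_pow, mul_comm]
  have hθ : ∀ (i : J) (m : ℕ), IsThetaValueOne ι (Ideal.span {π₀ ^ (m + 1)} * 𝔪) (𝔞 i)
      (algClosureEmb ι ((xf i m : rayClassField K (𝔪 * v.asIdeal ^ (m + 1))) : AlgebraicClosure K)) := fun i m =>
    (congrArg (fun I : Ideal (𝓞 K) => IsThetaValueOne ι I (𝔞 i)
      (algClosureEmb ι ((xf i m : rayClassField K (𝔪 * v.asIdeal ^ (m + 1))) : AlgebraicClosure K))) (hideal m)).mp (hxf i m)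
  have hglob : ∀ (i : J) (m : ℕ), j (Kc i) * ∏ c ∈ (S i).erase 0, ((xq m - j (x i c))⁻¹) ^ 6 =
      ((xf i m : rayClassField K (𝔪 * v.asIdeal ^ (m + 1))) : AlgebraicClosure K) := fun i m =>
    thetaAlg_eq_of_isThetaValueOne ι hL hΩ (hLa i) (hS i) (pow_ne_zero _ hπ₀0) (hc𝔣 m) j (Kc i) (x i) ((W.baseChange ℂ).b₂ / 12) (hKj i)
      (hxj i) (hxq m) (hθ i m)
  -- characteristic zero of the levels
  haveI : CharZero 𝒪[F] := e.toRingHom.charZero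
  haveI : CharZero F := charZero_of_injective_algebraMap (R := 𝒪[F]) (A := F) Subtype.val_injective
  haveI : CharZero (AlgebraicClosure F) := charZero_of_injective_algebraMap (algebraMap F (AlgebraicClosure F)).injective
  have htwo : ∀ (M : IntermediateField F (AlgebraicClosure F)), (2 : M) ≠ 0 := fun M h => by
    have h1 := congrArg (algebraMap M (AlgebraicClosure F)) h
    rw [map_ofNat, map_zero] at h1
    exact two_ne_zero h1
  -- assemble B10b
  refine exists_unit_forall_relColemanSeries_eq_subst_subst_of_divisionPoints e hq hπ heπ hA hP hV hp hϖ E hq hE hσ₀ ψ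
    (W.map (Int.castRingHom R)) hWR τ hτ (WeierstrassCurve.map_map_intCast W τ) x₀ y₀ (fun m => .some (XU m) (YU m) (hnU m))
    (fun m => hU m (hnU m)) (fun m => ?_) (fun m => ?_) XQ YQ h0 hnQ (fun m => ?_) β
    (fun i => PowerSeries.map ψ (C (Kc i) * ∏ c ∈ (S i).erase 0,
      PowerSeries.invOfUnit (((W.map (Int.castRingHom R)).translateX x₀ y₀).subst (W.map (Int.castRingHom R)).formalNeg - C (x i c))
        (uc i c) ^ 6)) (fun i => (S i).erase 0) Kc x uc hu (fun i => rfl) hKτ eι heT hinj hsurj hxτ (fun i m => ?_)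
  · -- (N2) the order `2^{m+1}`
    exact (addOrderOf_some_curveOver_of_readings e _ W (algClosureEmb ι) ιv L h₂ h₃
      (huL m) (hxu m) (hyu m) (hXU m) (hYU m) (hnU m)).trans (addOrderOf_toPoint_divisionPt_succ ι hL hΩ hβK h2K hprime hπ₁ m)
  · -- (N3) the `[π]`-coherence
    exact ltSMul_zPt_eq_inclPt_zPt_of_readings e hq hπ heπ hA hP W hV hp hϖ _ _ (sup_le_sup_left (ltField_mono hπ (Nat.le_succ m)) E)
      (algClosureEmb ι) ιv
      ((inclUnitBall (F := F) (le_sup_left : E ≤ E ⊔ ltField π (m + 1))).toRingHom.comp ψ)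
      j (fun r => hread (m + 1) r) L h₂ h₃ hT' hs hQr hPr hT0
      (by rw [PowerSeries.map_comp, RingHom.comp_apply, hTP, ← RingHom.comp_apply (PowerSeries.map _)
            (PowerSeries.map (algebraMap (LTCoeff F) (unitBall E))), ← PowerSeries.map_comp, AlgHom.toRingHom_eq_coe,
            inclUnitBall_comp_algebraMap])
      hidX hidY
      hΩL hπΩ' (huL m) (huL (m + 1)) (hΩu m) (hπΩu' m) (hαu m) (hQ m) hx₀ hy₀ hx₁' hy₁' (hxu m) (hyu m) (hxu (m + 1)) (hyu (m + 1))
      (hxw m) (hyw m) (hxz' m) (hyz' m) (hXU m) (hYU m) (hXU (m + 1)) (hYU (m + 1)) (hXW m) (hYW m) (hXZ m) (hYZ m) (hU m (hnU m))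
      (hU (m + 1) (hnU (m + 1)))
      ((addOrderOf_some_curveOver_of_readings e _ W (algClosureEmb ι) ιv L h₂ h₃
        (huL (m + 1)) (hxu (m + 1)) (hyu (m + 1)) (hXU (m + 1)) (hYU (m + 1)) (hnU (m + 1))).trans
        (addOrderOf_toPoint_divisionPt_succ ι hL hΩ hβK h2K hprime hπ₁ (m + 1)))
      (htwo _)
  · -- (he′) the chart identity `τ^{m+1}P₀ − U_m = ξ(Ω/π₀^{m+1})`
    exact some_sub_some_eq_some_curveOver_of_readings e _ W (algClosureEmb ι) ιv L h₂ h₃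
      (hqL m) (huL m) (hwL (m + 1)) (by ring) (hxq m) (hyq m) (hxu m) (hyu m) (hτx₀ m) (hτy₀ m) (hXQ m) (hYQ m) (hXU m) (hYU m)
      (hread m _) (hread m _) (hnQ m) (hnU m) (h0 m)
  · -- (hval_i) the value identity
    exact thetaAlg_eq_of_map_eq (algebraMap (E ⊔ ltField π m : IntermediateField F (AlgebraicClosure F))
      (AlgebraicClosure F)) ιv j ((S i).erase 0) (Kc i) (x i) (hglob i m)
      (hread m (Kc i)) (hXQ m) (fun c _ => hread m (x i c))
      (hβv i m)

end Summit.BirchSwinnertonDyer.BirchSwinnertonDyer.Theorems.PrintCf2.KatzMeasureJZeroSeam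

end
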